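import Summits.BirchSwinnertonDyer.BirchSwinnertonDyer.Theses.QuadraticBranchSignedControl
import Summits.BirchSwinnertonDyer.BirchSwinnertonDyer.Theorems.QuadraticBranchSignedControlPlusEtaNonsurjOfConjA
import Summits.BirchSwinnertonDyer.BirchSwinnertonDyer.Theorems.QuadraticBranchSignedControlPlusEtaNonsurjCMAnchorTransferByName
import HarnessLib

/-!
# Route `QuadraticBranchSignedControl` (rung K8, cell `bsd-potss`), residual crux `PlusEtaMainConjectureNonsurj`
# (stmt-BirchSwinnertonDyer-19606): the crux BY NAME from «(A) + analytic μ on the CM rows» + «the OPEN transfer binder» +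
# «the UNANCHORED non-CM rows» — a v7 `_of` candidate in which the non-CM primary stubs are re-cut by the existence of a
# CM UNIT ANCHOR (a `--supports` file; seat `bsd-potss-k8eta-c2` g8)

WHAT. k8eta-c2 g7's v6 candidate `EtaFineRoad.plusEtaMainConjectureNonsurj_of_conjA_partners_of_analyticMu_of_nonCM_lower` (p538498)
concludes the crux from Coates–Sujatha (A) on ALL partners + the analytic `μ = 0` on ALL rows + the Eisenstein stub on the non-CM rows
(modulo h22 h41 h6273 h26). With the CM-unit-anchor transfer road (this seat: OPEN binder `CorpuzLei2025_etaPlusMainConjecture_transfer_OPEN`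
p552245, road p552531, by name p555303) the NON-CM rows need neither (A) nor the analytic `μ` nor the Eisenstein inclusion whenever their
mod-`p` class contains a CM UNIT ANCHOR (census: all 30 non-CM rows below `5·10⁵`). THIS FILE composes:

  `PlusEtaMainConjectureNonsurj` ⟸ h22 h6273 h26 (named, published) + `hCL` (the OPEN binder, PRE) + hmod hGZK hS28 (named, published)
    + `hAcm`  : (A) for the additive partners of the CM twists only (= `Sig.stub_conjA_partners` restricted to `V.HasCM`; OPEN — Conjecture A
                for CM curves at an inert prime, Coates–Sujatha Thm. 3.4 ⟺ the classical `μ = 0` of `ℚ(W[p])_cyc`)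
    + `hμcm`  : the analytic `μ(L_p⁺(V,η,X)) = 0` on the CM rows (DISPLAYED analytic input, as in v5/v6)
    + `hunanch` : (C1⁺_η) on the non-CM rows of the crux WITHOUT a CM unit anchor datum (the proposed v7 stub
                `stub_etaMC_nonCM_unanchored`: EMPTY in-table, OPEN class-wide — nothing in print off the onto locus).

The anchored non-CM rows are discharged INSIDE the proof by `EtaCMAnchorTransferByName.quadraticBranchPlusEtaMainConjectureAt_of_cmUnitAnchor`.
The «CM unit anchor datum» of a pair `(V, p)` is spelled out (no definition is introduced): a globally minimal CM curve `A` with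
`L(A,1) ≠ 0`, `v_p(#Ш(A)_an) ≤ 0`, `p ∤ Tam(A)`, a globally minimal model `V′` of `A^{(p*)}` good at `p` with `a_p(V′) = 0`, and
`ModPCongruent V′ V p`.

HONEST FRAMING (cell `bsd-potss`; HUMAN RULING D-0036/D-0074): ONE BOOKKEEPING THEOREM — no definition, no new fact, no `sorry`, axioms
standard; CONDITIONAL on the named facts, on the OPEN binder `hCL` (unrefereed preprint, flag `CL25-eta-plus-dictionary`) and on the three
displayed stub-texts. It is NOT the registered `_of` of skeleton v5 (planner's call); 19606 stays OPEN; nothing is booked; BSD(W,p) is claimed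
for no pair. `--supports stmt-BirchSwinnertonDyer-19606`.

References: [CorpuzLei2025] Thms 1–3 (claim); [BurungaleTian2026] Thm. 2.6; [Kobayashi2003] Thm. 2.2, §4, Thm. 6.2/6.3/7.3, Cor. 7.2;
[CoatesSujatha2005] §3 (A), Thm. 3.4; [GreenbergVatsal2000] Thm. (1.4); [BurungaleFlach2024] Thm. 1.1, Cor. 2.
-/

set_option autoImplicit false
set_option linter.dupNamespace false

noncomputable section

open scoped Classical

open CongruenceSubgroup Field Function NumberField IsDedekindDomain WeierstrassCurve
open Literature.NumberTheory.EllipticCurves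
open Literature.NumberTheory.EllipticCurves.ModularForms
open Literature.NumberTheory.EllipticCurves.Rank1Residual
open Literature.NumberTheory.EllipticCurves.Rank1Residual.Typed
open Literature.NumberTheory.GaloisRepresentations
open Literature.NumberTheory.GaloisCohomology
open Literature.NumberTheory.EllipticCurves.IwasawaAlgebra
open Literature.NumberTheory.EllipticCurves.IwasawaDual ZpExtension
open Literature.NumberTheory.EllipticCurves.GreenbergVatsal2000
open Summit.BirchSwinnertonDyer.Rank1Residual.X11b.Levels
open Summit.BirchSwinnertonDyer.Rank1Residual.X11b
open Summit.BirchSwinnertonDyer.Rank1Residual.Additive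
open Summit.BirchSwinnertonDyer.Rank1Residual.Additive.SignedTwist
open scoped ContRepresentation
open Summit.BirchSwinnertonDyer.Rank1Residual.AdditivePotMult
open Summit.BirchSwinnertonDyer.Rank1Residual.O6 (ModPCongruent)
open Summit.BirchSwinnertonDyer.BirchSwinnertonDyer.Theses.QuadraticBranchSignedControl

namespace Summit.BirchSwinnertonDyer.BirchSwinnertonDyer.Theorems

namespace EtaCMAnchorTransferOf

/-- **The crux `PlusEtaMainConjectureNonsurj` BY NAME — v7 `_of` candidate.** From: Kobayashi Thm. 2.2η (`h22`), Thm. 6.2/6.3/7.3η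
(`h6273`), Burungale–Tian Thm. 2.6 (`h26`), modularity (`hmod`), GZK (`hGZK`), Burungale–Flach bsd.S28 (`hS28`) — named published facts;
the OPEN transfer binder `hCL` (Corpuz–Lei 2025, PRE); (A) on the additive partners of the CM twists (`hAcm`, OPEN); the analytic `μ = 0` on
the CM rows (`hμcm`, displayed); and (C1⁺_η) on the non-CM rows WITHOUT a CM unit anchor datum (`hunanch`, the proposed stub
`stub_etaMC_nonCM_unanchored` — empty in-table, open class-wide). CM rows: `EtaFineRoad.etaMC_cm_of_bt26_of_conjA_partners_of_analyticMu`;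
anchored non-CM rows: `EtaCMAnchorTransferByName.quadraticBranchPlusEtaMainConjectureAt_of_cmUnitAnchor`; the rest: `hunanch`. CONDITIONAL;
closes nothing by itself (two open stub-texts + one PRE binder in hypothesis position); nothing booked.
[claim: CorpuzLei2025, status: under-review] [cite: BurungaleTian2026, Thm. 2.6] [cite: Kobayashi2003, Thm. 2.2 (p. 5), §4 (p. 8), Thm. 6.2/6.3 (p. 11), Thm. 7.3 i) and Cor. 7.2]
[cite: CoatesSujatha2005, §3 statement (A) and Thm. 3.4] [cite: GreenbergVatsal2000, Thm. (1.4)] [cite: BurungaleFlach2024, Thm. 1.1 and Cor. 2] -/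
theorem plusEtaMainConjectureNonsurj_of_cmConjA_of_transfer_of_unanchored
    (h22 : Kobayashi2003.thm22_etaSignedSelmerDual_finite_torsion)
    (h6273 : Kobayashi2003.thm62_63_73_etaColemanPoitouTate)
    (h26 : BurungaleTian2026.thm26_etaKatoSequences_charIdeal_upToP_of_cm)
    (hCL : CorpuzLei2025_etaPlusMainConjecture_transfer_OPEN)
    (hmod : hasEntireLFunction_rat) (hGZK : rank_eq_analyticRank_of_analyticRank_le_one)
    (hS28 : bsdTriple_of_hasCM_of_L_one_ne_zero)
    (hAcm : ∀ (V : WeierstrassCurve ℚ) [V.IsElliptic] [V.IsGloballyMinimal] (W : WeierstrassCurve ℚ) [W.IsElliptic]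
      [W.IsGloballyMinimal] (C : VariableChange ℚ) (p : ℕ) [Fact p.Prime],
      5 ≤ p → C • W.quadraticTwist ((-1) ^ (p / 2) * p) = V →
      V.HasGoodReductionAtPrime p → V.frobeniusTrace p = 0 →
      ¬ (∀ m : ℕ, V.HasSurjectiveModNGaloisRep (p ^ m : ℕ)) → V.HasCM →
      ∀ (κ : ZpExtension ℚ p), κ.IsCyclotomic →
        ∃ (γ : absoluteGaloisGroup ℚ) (D : W.FineSelmerDualData κ γ),
          Module.Finite ℤ_[p] (RestrictScalars ℤ_[p] (IwasawaAlgebra p) D.X))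
    (hμcm : ∀ (V : WeierstrassCurve ℚ) [V.IsElliptic] [V.IsGloballyMinimal] (p : ℕ) [Fact p.Prime],
      5 ≤ p → V.HasGoodReductionAtPrime p → V.frobeniusTrace p = 0 →
      ¬ (∀ m : ℕ, V.HasSurjectiveModNGaloisRep (p ^ m : ℕ)) → V.HasCM →
      ∀ {N : ℕ} [NeZero N] {f : CuspForm (Gamma0 N) 2}, IsNewformOf V f →
        ∀ (ϖ : ℚ), (if Even (p / 2) then (ϖ : ℝ) * V.realPeriodRat = plusPeriod f
            else (ϖ : ℝ) * V.imaginaryPeriodRat = minusPeriod f) →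
        ∀ (Lη : IwasawaAlgebra p), IsQuadraticBranchPlusLFunction f p ϖ Lη → HasUnitContent Lη)
    (hunanch : ∀ (V : WeierstrassCurve ℚ) [V.IsElliptic] [V.IsGloballyMinimal] (p : ℕ) [Fact p.Prime],
      5 ≤ p → V.HasGoodReductionAtPrime p → V.frobeniusTrace p = 0 →
      ¬ (∀ m : ℕ, V.HasSurjectiveModNGaloisRep (p ^ m : ℕ)) → ¬ V.HasCM →
      ¬ (∃ (A : WeierstrassCurve ℚ) (_ : A.IsElliptic) (_ : A.IsGloballyMinimal)
          (V' : WeierstrassCurve ℚ) (_ : V'.IsElliptic) (_ : V'.IsGloballyMinimal) (C' : VariableChange ℚ),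
          A.HasCM ∧ A.entireLFunction 1 ≠ 0 ∧ (∃ s : ℚ, shaAn A = (s : ℂ) ∧ padicValRat p s ≤ 0) ∧
          ¬ p ∣ A.tamagawaProduct ∧ C' • A.quadraticTwist ((-1) ^ (p / 2) * p) = V' ∧
          V'.HasGoodReductionAtPrime p ∧ V'.frobeniusTrace p = 0 ∧ ModPCongruent V' V p) →
      QuadraticBranchPlusEtaMainConjectureAt V p) :
    PlusEtaMainConjectureNonsurj := by
  intro V _ _ p _ hp5 hgood hap hns
  by_cases hCM : V.HasCM
  · exact EtaFineRoad.etaMC_cm_of_bt26_of_conjA_partners_of_analyticMu h26 h22 h6273 hAcm hμcm V p hp5 hgood hap hns hCM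
  · by_cases hanc : ∃ (A : WeierstrassCurve ℚ) (_ : A.IsElliptic) (_ : A.IsGloballyMinimal)
        (V' : WeierstrassCurve ℚ) (_ : V'.IsElliptic) (_ : V'.IsGloballyMinimal) (C' : VariableChange ℚ),
        A.HasCM ∧ A.entireLFunction 1 ≠ 0 ∧ (∃ s : ℚ, shaAn A = (s : ℂ) ∧ padicValRat p s ≤ 0) ∧
        ¬ p ∣ A.tamagawaProduct ∧ C' • A.quadraticTwist ((-1) ^ (p / 2) * p) = V' ∧
        V'.HasGoodReductionAtPrime p ∧ V'.frobeniusTrace p = 0 ∧ ModPCongruent V' V p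
    · obtain ⟨A, _, _, V', _, _, C', hACM, hLA, hsha, htam, hC'V', hgood', hap', hcong⟩ := hanc
      exact EtaCMAnchorTransferByName.quadraticBranchPlusEtaMainConjectureAt_of_cmUnitAnchor hCL hmod hGZK hS28 p hp5 A
        hACM hLA hsha htam V' C' hC'V' hgood' hap' V hgood hap hcong
    · exact hunanch V p hp5 hgood hap hns hCM hanc

end EtaCMAnchorTransferOf

end Summit.BirchSwinnertonDyer.BirchSwinnertonDyer.Theorems

end
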